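import Summits.QuantumFields.YangMills.Theorems.BalabanUVNodesN13Cor3AsymJunctionThm2SupplyFullBudgetAtRecord13CoPH

/-!
# BalabanUVNodes ∕ N13 — THE N11 → N13 EDGE END AT NODE 00's STAGE-13 RECORD WITH THEOREM 2 KEYED **AT PRINT's REGULARITY CLASS OF RECORD** `Node00.bgReg`: parts 1 ∕ 2
# (p606459 ∕ p607455) with the background class pinned to [I] (1.2)'s plaquette-small class, in which def-R's `Node00.Uk` chooses the minimiser — the identification row `hU`
# DISCHARGED for every configuration, Theorem 2's tokens on print's own range «sufficiently regular configurations U_k = U_k(V)»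
# (Track A, DAG node N13 = [B16]; cluster K1 — K1⁷ `StabilityBAtRecordR13SepCoPH` = stmt-QuantumFields-20542, helper `--as helper`; seat `pub-ymgap-dag-n13-w2` g3, own-lineage
# successor of parts 1 ∕ 2; 2026-08-28; count-neutral)

[B16] = T. Bałaban, *Large field renormalization. II. Localization, exponentiation, and bounds for the 𝐑 operation*, Commun. Math. Phys. **122** (1989) 355–392
[Balaban1989LargeFieldII]; [III] = [Balaban1988Convergent] Thm 2 p. 263, (2.28) p. 259, (2.41)–(2.50) pp. 261–264, §3 p. 283; [I] = [Balaban1987RG1] (0.21) p. 256, (1.1)–(1.2) p. 260.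
statement-level bookkeeping of a published proof with citation tags; proofs kernel-checked; nothing here is a claim about the Yang–Mills mass gap

CITATION HEADER (verbatim, text layer).  [III] p. 263: *"Theorem 2. Under the assumptions of Theorem 1 there exists a constant E₁ independent of j, k, Ω, {Ω_j}, {Λ_j}, T
(but dependent on the other constants occurring in the formulation of this theorem), such that"* (2.43) *"for β < 1, and sufficiently regular configurations U_k = U_k(V), e.g. for V
restricted by the characteristic functions in (2.18)"*; p. 259 (2.27)(ii): *"there exists an analytic function E^{(j)}(X,(U,J),z) of the variables (U,J) ∈ U_j(X, α_{0,j}, α_{1,j}),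
which is an extension of this term"* and p. 261: *"This definition gives a more detailed and precise form, suitable for our inductive constructions, of the regularity conditions for
background fields, introduced in [13–15]"* (v1.0.1 ERRATUM, dag-ref-M g8 READ-111b NIT-1: v1.0's p. 259 sentence «the inductive assumptions (2.7) imply U_k ∈ U^c_j(X, α_{0,j}, α_{1,j}) for
proper restrictions on ε_j» was a PARAPHRASE of these two sentences mislabelled verbatim — it is NOT in [III]'s text layer; it backs only the displayed row `hreg`, no Lean depends on it);
p. 264: *"Corollary 3 (Ultraviolet Stability). Under the assumptions of Theorem 1 there exist constants E₋, E₊ independent of η and T, but depending on g_k, such that"* (2.50).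
[I] p. 260 (1.2): the regularity class `|U(∂p) − 1| < ε₀η²` of the variational problem (0.21) p. 256 (def-R `Node00.bgReg`, `Node00.Uk`).

VERSIONS.  v1.0 p609885 ✓ (2026-08-28T06:23Z).  v1.0.1 (this edition, dag-n13-w2 g4): DOCSTRING-ONLY — the citation header's and the main theorem docstring's p. 259 sentence corrected
(dag-ref-M g8 READ-111b NIT-1: a paraphrase had been labelled verbatim), count phrase aligned (NIT-2); every declaration (statement and proof) BYTE-IDENTICAL to v1.0.

WHY THIS FILE.  Parts 1 ∕ 2 key [III] Theorem 2 (resp. its §3 supply tokens) to an ABSTRACT background class `𝒰 k s` and therefore carry the identification row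
`hU : U_k(V) ∈ 𝒰 k (s V)` at every configuration (EVIDENCE #42 (b)).  But the class the N13 END actually needs is `{U_k(V) : V}`, and def-R's `Node00.Uk` (FILE
`BackgroundActionOfRecord`) is TOTAL with a documented dichotomy: on the solvable set `U_k(V)` is [B11] Thm 1's minimiser INSIDE the (1.2) class `bgReg F N K k ε_bg`
(`Uk_mem_bgReg`), off it `U_k(V) = 1` (`Uk_of_not`) — and `1` is plaquette-small for `ε_bg > 0`.  So `{U_k(V)} ⊆ bgReg` (§0), and keying Theorem 2 AT `bgReg` is exactly print's
range p. 263 «sufficiently regular configurations U_k = U_k(V)»: the row `hU` disappears (§1), and in the chain ∕ supply edition (§2) the (2.41)(ii)-regularity row becomes the one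
recognisable sentence «(1.2)-regular ⟹ in `Ũ^c_j(X)`» (p. 259's remark, [14] ∕ [15]; def-R's row `bg` for the single-field background) instead of a row about an unnamed class.

WHAT THIS FILE PROVES (3 theorems, 0 `def`, 0 `sorry`; BY NAME over parts 1 ∕ 2 and def-R's `Uk_mem_bgReg` ∕ `Uk_of_not` ∕ `mem_bgReg_iff`).
§0 `Uk_mem_bgReg_all` — `0 < ε → ∀ V, Uk F N K k ε V ∈ bgReg F N K k ε` (two branches).
§1 ★★ `uvIneq_at_record₁₃CoPH_of_ineq243_ineq244_keyedAtBgReg_of_fullBudget` — part 1 §1 at `𝒰 := bgReg`, `hU` GONE.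
§2 ★★★ `uvIneq_at_record₁₃CoPH_of_thm2Supply_chainWitness_atBgReg_of_fullBudget` — part 2 at `𝒰 := bgReg`, `hU` GONE, `h𝒰 ↦ hreg`.

HONEST SCOPE ∕ A6.  By-name junction, count-neutral, LOCATED as EVIDENCE #42: `hH` (the (2.18)→(1.72) dictionary of `densOfRecord₁₃`) has NO supplier; `hA'eq` ∕ `hφ1` remain
identification rows (faces of that object); `hU` is now a THEOREM (§0).  Theorem 2 keyed ∕ the §3 supply tokens ON `bgReg` (print's range; their inhabitant is [III] §3's analysis —
LOCATED, nobody's theorem), `hreg`, the chain's obligations, (1.79)∕(1.80)∕(1.80)⁺, the (1.90) gas stay HYPOTHESES; nothing of Bałaban's asserted; N11 ∕ N13 NOT discharged; K0⁷ ∕ K1⁷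
NOT closed (`stub_nodes13PWS` ∕ `stub_runRows13PWS` NOT proved); counts UNMOVED (typed 28∕28 · discharged 5∕28 = nodes 5∕27 + NODE O 0∕1; v1.0.1: count phrase aligned to the
record, dag-ref-M NIT-2); one finite `𝕋⁴_{L^K}` programme at fixed `ε = L^{−K}`, Bałaban
AS PRINTED; R4 closes the conditional finite-𝕋⁴ rung `BalabanLadder.UV` only — the Yang–Mills mass gap (Clay) is NOT proved by any of this; nothing continuum ∕ ℝ⁴ ∕ OS.
No `def`, no `sorry`, no `instance`, no `notation`. -/

noncomputable section

open MeasureTheory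
open scoped BigOperators Matrix.Norms.L2Operator

namespace Summit.QuantumFields.YangMills.BalabanUVNodes.N13Cor3AsymJunctionThm2KeyedAtBgRegFullBudgetAtRecord13CoPH

open Literature.MathematicalPhysics.QuantumFieldTheory.Balaban1983to89 Step B14.Eq225Concrete B14.LocalCoupling B14Thm2 Finset
open T4Continuum T4DatumAssembly Node00 DagBinding FlowStepRuns B15DeterminingSets
open B10Eq38TorusDomains (toFine)
open B16Cor3Ops (PosOp Repr172)
open TreeLengthTorus (tsys proj TPt TAdj)
open B13FamilySum (Ineq126 VolBound)
open B16Eq190Resummation (bracket mayerTerm F191 polys190 LocalOps DepOn)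
open B13ScaleTransfer (Pt FaceConnected)
open TreeLength (treeLen)
open B16SProfile (Sop)
open B13Factor210Literal (fineCubes)
open Summit.QuantumFields.YangMills.Theorems.BalabanUVNodesN11Sect3SupplyChainDefs (Sect3Supplier chainWitness)
open Summit.QuantumFields.YangMills.Theorems.BalabanUVNodesN11Sect3SupplyChainObligationsDefs (SupplierObligations NoExpansionObligation ChainFormAt
  chainFormAt_all_of_obligations)
open Summit.QuantumFields.YangMills.Theorems.BalabanUVNodesN11Thm2Sect2DataOfRecordKeyedDefs (sect2DataOfRecord₁₃Keyed)
open Summit.QuantumFields.YangMills.Theorems.BalabanUVNodesN11Thm2AlongSupplyChain (h248_chainWitness_of_chainFormAt)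

open Summit.QuantumFields.YangMills.Theorems.BalabanUVNodesN11Thm2SupplyDefs (Thm2ESupplyAt Thm2RSupplyAt ineq243_keyed_of_eSupply ineq244_keyed_of_rSupply)
open Summit.QuantumFields.YangMills.BalabanUVNodes.N13Cor3AsymJunctionThm2KeyedFullBudgetAtRecord13CoPH (uvIneq_at_record₁₃CoPH_of_ineq243_ineq244_keyed_of_fullBudget)
open Summit.QuantumFields.YangMills.BalabanUVNodes.N13Cor3AsymJunctionThm2SupplyFullBudgetAtRecord13CoPH (uvIneq_at_record₁₃CoPH_of_thm2Supply_chainWitness_of_obligations_of_fullBudget)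

/-! ## §0. The backgrounds of record lie in print's (1.2) regularity class — both branches of def-R's total `U_k` -/

/-- **`U_k(V) ∈ U_k(ε)` FOR EVERY CONFIGURATION `V`** (not only on the solvable set): def-R's `Node00.Uk` is [B11] Thm 1's minimiser chosen INSIDE `bgReg F N K k ε`
when the variational problem (0.21) is solvable in that class (`Uk_mem_bgReg`), and the unit configuration otherwise (`Uk_of_not`) — whose plaquette variables are `1`, hence
`ε·η_k²`-small as soon as `0 < ε` (`η_k = L^{−k} > 0`). [cite: Balaban1987RG1, (1.2) p.260, (0.21) p.256 (bookkeeping)] -/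
theorem Uk_mem_bgReg_all (F : T4Family) (N : ℕ) [NeZero N] (K k : ℕ) {ε : ℝ} (hε : 0 < ε) (V : GaugeField (F.P K) k (SU N)) :
    Uk F N K k ε V ∈ bgReg F N K k ε := by
  classical
  by_cases h : UkExists F N K k ε V
  · exact Uk_mem_bgReg h
  · rw [Uk_of_not h, mem_bgReg_iff]
    intro p
    have hη : 0 < ε * (F.P K).eta k ^ 2 :=
      mul_pos hε (pow_pos (by unfold Params.eta; exact pow_pos (inv_pos.mpr (Nat.cast_pos.mpr (F.P K).L_pos)) _) 2)
    simpa [GaugeField.plaqHol, GaugeGroup.dist1_one] using hη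

/-! ## §1. Part 1 §1 keyed AT `bgReg`: the identification row `hU` gone -/

section KeyedAtBgReg

variable (F : T4Family) (N : ℕ) [NeZero N]
variable (θ : Stage13HParams F N) (h : θ.Provisos₁₃CoPH F N) (P : B12.RunParams) (k : ℕ)
variable (𝒯 : (k : ℕ) → SeqOfRecord F θ.ν θ.τ9.M (gOfRecord₁₃ F N θ.toStage13Params P) P.K k → Sect2.TermValues (F.P P.K) (MatA N) (FluctV N) θ.τ9.M)

open Classical in
/-- **★★ (UV₁₃) AT LEVEL `k ≤ K` OF THE RUN `P` AT NODE 00's STAGE-13 RECORD FROM `Ineq243 ∧ Ineq244` KEYED AT PRINT's REGULARITY CLASS OF RECORD + THE PRINTED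
BUDGET** — part 1 §1 `uvIneq_at_record₁₃CoPH_of_ineq243_ineq244_keyed_of_fullBudget` with the background class `𝒰 := fun k _ ↦ Node00.bgReg F N P.K k θ.εbg` ([I] (1.2)
p. 260, «|U(∂p) − 1| < ε₀η²» — the class in which def-R's `Node00.Uk` CHOOSES [B11] Thm 1's minimiser): the identification row `hU : U_k(V) ∈ 𝒰 k (s V)` is GONE
(§0 `Uk_mem_bgReg_all`, one numerics letter `0 < ε_bg` instead), and Theorem 2's two keyed tokens `h243K` ∕ `h244K` now live on the carrier
`sect2DataOfRecord₁₃Keyed θ P 𝒯 (fun k _ ↦ bgReg …)` — print's own range, p. 263: *"for β < 1, and sufficiently regular configurations U_k = U_k(V)"*.  Every other binder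
VERBATIM from part 1 §1 (history `s V`, term values `𝒯 k (s V)`, `hΓvol`, `hk`, `hg`, (2.48) `h248`, the seam `hA'eq`, `hφ ∕ hφ1`, `hβj`, (2.46)'s inputs, `hvac`, `hlog ∕ hlog'`,
`hΓ`, `hCA`, the budget data, the (1.90) gas, `hH`).  CONDITIONAL on every input — LOCATED (`hH` has no supplier; `hA'eq` ∕ `hφ1` are what `R` is); [III] Theorem 2 ∕ Cor. 3 NOT
proved; nothing of Bałaban's asserted; count-neutral.
[cite: Balaban1988Convergent, Thm 2 (2.43)–(2.44) p.263, (2.45)–(2.50) pp.263–264; Balaban1987RG1, (1.2) p.260, (0.21) p.256; Balaban1989LargeFieldII, (0.1) p.356, (1.72) p.379, (1.80) p.384, p.387 ll.21–27, p.391] -/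
theorem uvIneq_at_record₁₃CoPH_of_ineq243_ineq244_keyedAtBgReg_of_fullBudget (Nc : ℕ) [NeZero Nc] (R : Repr172 (GaugeField (F.P P.K) k (SU N)) (tsys 4 Nc).Dom)
    {M₁ : ℝ} (hM : M₁ ≠ 0) (hnum : (Fintype.card (Site (F.P P.K) k) : ℝ) = (M₁ * Nc) ^ 4)
    {κ₁ : ℝ} (hκ : B12TreeDecay.kappa₀ (4 * 2 ^ 4) (2 * 4) ≤ κ₁) (hκ₁ : 0 ≤ κ₁) (c₀ : ℝ)
    (hH : R.Holds (densOfRecord₁₃ F N θ.toStage13Params P k))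
    (hχ01 : ∀ a V, 0 ≤ R.χ a V ∧ R.χ a V ≤ 1)
    (h0χ : ∀ V, R.χ R.allSmall V = chiβOfRecord₁₃ F N θ.toStage13Params P.K (gOfRecord₁₃ F N θ.toStage13Params P) k V)
    -- the components of `Z_k`: composite structure and per-component (1.79)/(1.80) data
    (T : R.Adm → (tsys 4 Nc).Dom → PosOp (GaugeField (F.P P.K) k (SU N))) (l : R.Adm → List (tsys 4 Nc).Dom)
    (hnd : ∀ a, (l a).Nodup) (hset : ∀ a, (l a).toFinset = R.Zc a)
    (hTZ : ∀ a Fn V, (R.TZ a).T Fn V = (PosOp.pi (T a) (l a)).T Fn V)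
    (b : Step.Budget.Consts) (Lb : ℝ) {Rk q : ℕ} (hRk : 0 < Rk) (hq : 0 < q)
    (hC : 0 ≤ b.C) (hbM : 0 ≤ b.M) (hRm : ∀ m, 0 ≤ b.R m) (hdim : b.d = 4) (hRq : ((Rk * q : ℕ) : ℝ) = Lb * b.R (k + 1)) (hLb : 0 ≤ Lb)
    (hslope2 : 2 * (κ₁ * (4 * 2 ^ 4) * Lb ^ b.d) ≤ b.C * b.M ^ b.d * b.R (k + 1))
    (X₀ : R.Adm → (tsys 4 Nc).Dom → Finset (Pt 4)) (K : R.Adm → (tsys 4 Nc).Dom → ℕ)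
    (κ Pp : R.Adm → (tsys 4 Nc).Dom → ℝ) (s : R.Adm → (tsys 4 Nc).Dom → ℕ → ℝ)
    (hdataZ : ∀ a, ∀ X ∈ R.Zc a, (X₀ a X).Nonempty ∧ FaceConnected (X₀ a X) ∧
      X.1 = (fineCubes Rk (X₀ a X)).image (proj Nc) ∧ 1 ≤ K a X ∧
      (∀ V, (T a X).T 1 V ≤ Real.exp (-(κ a X) - Pp a X)) ∧ Step.Budget.Controls b k (K a X) (κ a X) (s a X) ∧
      (∀ m, 0 ≤ s a X m) ∧ s a X (k + 1) = treeLen (Sop q (X₀ a X)) ∧ c₀ ≤ Pp a X)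
    -- the domains `Y_i`: composite structure and per-domain (1.80)⁺ horizon-0 data
    (TY : R.Adm → (tsys 4 Nc).Dom → PosOp (GaugeField (F.P P.K) k (SU N))) (lY : R.Adm → List (tsys 4 Nc).Dom)
    (hndY : ∀ a, (lY a).Nodup) (hsetY : ∀ a, (lY a).toFinset = R.Ys a)
    (hTYs : ∀ a Fn V, (R.TYs a).T Fn V = (PosOp.pi (TY a) (lY a)).T Fn V)
    (SY : R.Adm → (tsys 4 Nc).Dom → Finset (Pt 4)) (κY PY : R.Adm → (tsys 4 Nc).Dom → ℝ) (sY : R.Adm → (tsys 4 Nc).Dom → ℕ → ℝ)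
    (hdataY : ∀ a, ∀ Y ∈ R.Ys a, (SY a Y).Nonempty ∧ FaceConnected (SY a Y) ∧
      Y.1 = (fineCubes Rk (SY a Y)).image (proj Nc) ∧ (∀ V, (TY a Y).T 1 V ≤ Real.exp (-(κY a Y) - PY a Y)) ∧
      Step.Budget.Controls b k 0 (κY a Y - κ₁ * treeLen (fineCubes Rk (SY a Y))) (sY a Y) ∧ c₀ ≤ PY a Y)
    -- the (1.90) gas of every admissible term (verbatim)
    {LF DomY Cube Var Sv : Type*} [Fintype LF] [Fintype DomY] [Fintype Cube] [DecidableEq LF] [DecidableEq DomY]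
    [DecidableEq Cube] {adjC : Cube → Cube → Prop} [DecidableRel adjC]
    (hrefl : ∀ a, adjC a a) (hsymm : ∀ a b, adjC a b → adjC b a)
    {locX : LF → Finset Cube} {locY : DomY → Finset Cube} {site : Var → Cube} (Yfix : R.Adm → Finset Cube)
    (houtX : ∀ a j, (locX j \ Yfix a).Nonempty) (houtY : ∀ a Y, (locY Y \ Yfix a).Nonempty)
    (Op : R.Adm → Finset LF → ((Var → Sv) → ℂ) →+ ((Var → Sv) → ℂ))
    (hOps : ∀ a, LocalOps adjC locX (Yfix a) site (Op a))
    (hOpReal : ∀ a (S : Finset LF) (f : (Var → Sv) → ℂ), (∀ ψ, (f ψ).im = 0) → ∀ φ, (Op a S f φ).im = 0)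
    (Vt : R.Adm → DomY → (Var → Sv) → ℂ) (hV : ∀ a Y, DepOn (Yfix a) site (Vt a Y) (locY Y))
    (hVreal : ∀ a Y ψ, (Vt a Y ψ).im = 0) (cfg : GaugeField (F.P P.K) k (SU N) → (Var → Sv))
    {nbr : Cube → Finset Cube} (hnbr : ∀ a b, adjC a b → a ∈ nbr b) {νn : ℝ} (hν : ∀ b, ((nbr b).card : ℝ) ≤ νn)
    {d : R.Adm → Finset Cube → ℝ} {c₁ Rr κc K₀ cv τ : ℝ} (hd : ∀ a X, 0 ≤ d a X) (hc₁ : 0 ≤ c₁) (hK₀ : 0 ≤ K₀) (hτ : 0 ≤ τ)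
    (h197 : ∀ a V X, ‖F191 adjC locX locY (Yfix a) (mayerTerm (Op a) (Vt a) (cfg V)) X‖ ≤ c₁ * Real.exp (-(Rr * d a X)))
    (h126 : ∀ a, Ineq126 (polys190 adjC locX locY (Yfix a)) (fun X => X \ Yfix a) (d a) κc K₀)
    (hvol : ∀ a, VolBound (polys190 adjC locX locY (Yfix a)) (fun X => X \ Yfix a) (d a) cv)
    (hrate : κc + τ * cv ≤ Rr) (hsmall : c₁ * Real.exp (τ * cv) * K₀ * νn ≤ τ)
    (hjunction : ∀ a V, R.curly a V = (bracket (Op a) (Vt a) (cfg V)).re)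
    {πc : ℝ} (hQ : (Fintype.card Cube : ℝ) ≤ πc * (Fintype.card (Site (F.P P.K) k) : ℝ))
    -- [III] Theorem 2 KEYED AT PRINT's REGULARITY CLASS `bgReg` ([I] (1.2)): the two tokens, the level in range, couplings `≥ 0`, `ε_bg > 0`
    {L β E₁ R₁ : ℝ} {κ₀ : ℕ}
    (h243K : Ineq243 (sect2DataOfRecord₁₃Keyed θ P 𝒯 (fun k _ => bgReg F N P.K k θ.εbg)) L β E₁) (h244K : Ineq244 (sect2DataOfRecord₁₃Keyed θ P 𝒯 (fun k _ => bgReg F N P.K k θ.εbg)) R₁ κ₀)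
    (hL : 1 < L) (hβ : 0 < β) (hE : 0 ≤ E₁) (hR₁ : 0 ≤ R₁) (hκ₀ : 7 ≤ κ₀) (hk : k ≤ P.K) (hε : 0 < θ.εbg)
    (hg : ∀ j, j ≤ P.K → 0 ≤ gOfRecord₁₃ F N θ.toStage13Params P j)
    -- the configuration-indexed data READ THROUGH THE CARRIER: history, fluctuation argument, volumes (membership of `U_k(V)` is §0)
    (sV : (V : GaugeField (F.P P.K) k (SU N)) → SeqOfRecord F θ.ν θ.τ9.M (gOfRecord₁₃ F N θ.toStage13Params P) P.K k)
    (aV : GaugeField (F.P P.K) k (SU N) → Tk.SFluct (F.P P.K) (FluctV N))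
    (Ek EkLog EkRest : ℝ) (hEk : Ek = EkLog + EkRest) (B₁ E₂ : ℝ) (Γ : ℕ → ℝ)
    (hΓvol : ∀ V, ∀ n, 1 ≤ n → n ≤ k → ((univ.filter fun y : Site (F.P P.K) n => toFine n y ∈ gammaRegion (sV V).Ω k n).card : ℝ) ≤ Γ n)
    (hβj : ∀ j, 1 ≤ j → j ≤ k → 0 ≤ 1 / gOfRecord₁₃ F N θ.toStage13Params P (j - 1) ^ 2 - 1 / gOfRecord₁₃ F N θ.toStage13Params P j ^ 2)
    (hφ : ∀ V, ∀ j, 1 ≤ j → j ≤ k → ∀ x, θ.Phih P k (sV V).Ω (sV V).Λ j x ≤ 1)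
    (hφ1 : ∀ V, chiβOfRecord₁₃ F N θ.toStage13Params P.K (gOfRecord₁₃ F N θ.toStage13Params P) k V ≠ 0 →
      ∀ j, 1 ≤ j → j ≤ k → ∀ x, θ.Phih P k (sV V).Ω (sV V).Λ j x = 1)
    (hsum : ∀ n, 1 ≤ n → n ≤ k → ∑ j ∈ Icc 1 n, (gOfRecord₁₃ F N θ.toStage13Params P j) ^ κ₀ ≤ (gOfRecord₁₃ F N θ.toStage13Params P n) ^ (κ₀ - 6))
    (hsmall6 : ∀ n, 1 ≤ n → n ≤ k → R₁ * (gOfRecord₁₃ F N θ.toStage13Params P n) ^ (κ₀ - 6) ≤ 1)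
    (h248 : ∀ V, |B240 (sect2TowerOfRecord F N (FluctV N) P.K (settingOfRecord₁₃ F N θ.toStage13Params P) (θ.rzAt P (sV V)) (sV V) (𝒯 k (sV V)))
        (fun j X => Sect2.admB (F.P P.K) θ.ν θ.τ9.M (gOfRecord₁₃ F N θ.toStage13Params P) (sV V).Ω (sV V).Λ j (Sect2.domSites (F.P P.K) θ.τ9.M j X)) (aV V) k
        (Uk F N P.K k θ.εbg V)| ≤ 2 * B₁ * ∑ n ∈ Icc 1 k, Γ n)
    (hvac : VacuumRestBound EkRest E₂ Γ k)
    (hA'eq : ∀ V, R.A' V =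
      (sect2ActionDataOfRecord F N (FluctV N) P.K (settingOfRecord₁₃ F N θ.toStage13Params P) (θ.rzAt P (sV V)) (sV V) (𝒯 k (sV V)) (aV V) Ek).action23 k
        (Uk F N P.K k θ.εbg V))
    -- the sizes of the logarithmic vacuum term, the volume majorant, the sign of Theorem 2's constant
    {cΓ cL cL' : ℝ} (hCA : 0 ≤ E₁ * (1 - L ^ (-β))⁻¹ + 1 + 2 * B₁ + E₂)
    (hΓ : ∑ n ∈ Icc 1 k, Γ n ≤ cΓ * (Fintype.card (Site (F.P P.K) k) : ℝ))
    (hlog : -(cL * (Fintype.card (Site (F.P P.K) k) : ℝ)) ≤ -EkLog)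
    (hlog' : -EkLog ≤ cL' * (Fintype.card (Site (F.P P.K) k) : ℝ)) :
    ∀ V : GaugeField (F.P P.K) k (SU N),
      B16.UVIneq ((datumOfRecord₁₃CoPH F N θ h).C P) k V
        ((E₁ * (1 - L ^ (-β))⁻¹ + 1 + 2 * B₁ + E₂) * cΓ + cL + πc * (c₁ * Real.exp (τ * cv) * K₀))
        ((E₁ * (1 - L ^ (-β))⁻¹ + 1 + 2 * B₁ + E₂) * cΓ + cL' + πc * (c₁ * Real.exp (τ * cv) * K₀) +
          M₁⁻¹ ^ 4 * B12TreeDecay.K₀ (4 * 2 ^ 4) (2 * 4) * ∑ _i : Fin 2, Real.exp (-c₀)) :=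
  uvIneq_at_record₁₃CoPH_of_ineq243_ineq244_keyed_of_fullBudget F N θ h P k 𝒯 (fun k _ => bgReg F N P.K k θ.εbg) Nc R hM hnum hκ hκ₁ c₀ hH hχ01 h0χ T l
    hnd hset hTZ b Lb hRk hq hC hbM hRm hdim hRq hLb hslope2 X₀ K κ Pp s hdataZ TY lY hndY hsetY hTYs SY κY PY sY hdataY hrefl hsymm Yfix houtX houtY Op hOps
    hOpReal Vt hV hVreal cfg hnbr hν hd hc₁ hK₀ hτ h197 h126 hvol hrate hsmall hjunction hQ h243K h244K hL hβ hE hR₁ hκ₀ hk hg sV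
    (fun V => Uk_mem_bgReg_all F N P.K k hε V) aV Ek EkLog EkRest hEk B₁ E₂ Γ hΓvol hβj hφ hφ1 hsum hsmall6 h248 hvac hA'eq hCA hΓ hlog hlog'

end KeyedAtBgReg

/-! ## §2. Part 2 (supply ∕ chain edition) keyed AT `bgReg`: `hU` gone, the regularity row = «(1.2)-regular ⟹ (2.41)(ii)-regular» -/

section SupplyAtBgReg

variable (F : T4Family) (N : ℕ) [NeZero N]
variable (θ : Stage13HParams F N) (h : θ.Provisos₁₃CoPH F N) (P : B12.RunParams) (k : ℕ)

open Classical in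
/-- **★★★ (UV₁₃) AT LEVEL `k ≤ K` OF THE RUN `P` AT NODE 00's STAGE-13 RECORD ALONG dag-n11-e's SUPPLY CHAIN FROM [III] §3's TWO SUPPLY TOKENS KEYED AT PRINT's REGULARITY
CLASS OF RECORD + THE PRINTED BUDGET** — part 2's `uvIneq_at_record₁₃CoPH_of_thm2Supply_chainWitness_of_obligations_of_fullBudget` with `𝒰 := fun k _ ↦ Node00.bgReg F N P.K k θ.εbg`:
the supply tokens `Thm2ESupplyAt ∕ Thm2RSupplyAt` at the chain witness ON `bgReg` (print p. 263's range «sufficiently regular configurations U_k = U_k(V)»), the identification row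
`hU` GONE (§0, with `0 < ε_bg` from admissibility `hθ`), and the (2.41)(ii)-regularity row now the ONE recognisable displayed sentence `hreg` : «(1.2)-regular ⟹ in `Ũ^c_j(X)` on the boundary-term range» — a READING
of print p. 259 (2.27)(ii) *"there exists an analytic function E^{(j)}(X,(U,J),z) of the variables (U,J) ∈ U_j(X, α_{0,j}, α_{1,j})"* with p. 261 *"a more detailed and precise form … of the
regularity conditions for background fields, introduced in [13–15]"* (v1.0.1 ERRATUM, dag-ref-M READ-111b: v1.0 printed a paraphrase here as a quotation), [14] ∕ [15] — def-R's row `bg` sentence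
(`BgProvisoΛ`) read for single-field backgrounds; (2.48) discharged along the chain as in part 2; explicit constants `E₁ := cE`, `R₁ := cR·K₀(4·2^d,2d)`, `L := F.L`, `β := 1 − b`.  CONDITIONAL on every
input — LOCATED as parts 1 ∕ 2 (`hH`, `hA'eq`, `hφ1`); the supply tokens, `hreg`, the obligations `(hσ, hT)`, (1.79)∕(1.80)∕(1.80)⁺, the (1.90) gas are HYPOTHESES ([III] §3's analysis NOT
proved); nothing of Bałaban's asserted; N11 ∕ N13 NOT discharged; count-neutral.
[cite: Balaban1988Convergent, (3.65)–(3.67) p.283, Thm 2 p.263, (2.28) p.259, (2.41)–(2.42) p.261, (2.45)–(2.50) pp.263–264; Balaban1987RG1, (1.2) p.260; Balaban1989LargeFieldII, (0.1) p.356, (1.72) p.379, p.387 ll.21–27] -/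
theorem uvIneq_at_record₁₃CoPH_of_thm2Supply_chainWitness_atBgReg_of_fullBudget (Nc : ℕ) [NeZero Nc] (R : Repr172 (GaugeField (F.P P.K) k (SU N)) (tsys 4 Nc).Dom)
    {M₁ : ℝ} (hM : M₁ ≠ 0) (hnum : (Fintype.card (Site (F.P P.K) k) : ℝ) = (M₁ * Nc) ^ 4)
    {κ₁ : ℝ} (hκ : B12TreeDecay.kappa₀ (4 * 2 ^ 4) (2 * 4) ≤ κ₁) (hκ₁ : 0 ≤ κ₁) (c₀ : ℝ)
    (hH : R.Holds (densOfRecord₁₃ F N θ.toStage13Params P k))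
    (hχ01 : ∀ a V, 0 ≤ R.χ a V ∧ R.χ a V ≤ 1)
    (h0χ : ∀ V, R.χ R.allSmall V = chiβOfRecord₁₃ F N θ.toStage13Params P.K (gOfRecord₁₃ F N θ.toStage13Params P) k V)
    -- the components of `Z_k`: composite structure and per-component (1.79)/(1.80) data
    (T : R.Adm → (tsys 4 Nc).Dom → PosOp (GaugeField (F.P P.K) k (SU N))) (l : R.Adm → List (tsys 4 Nc).Dom)
    (hnd : ∀ a, (l a).Nodup) (hset : ∀ a, (l a).toFinset = R.Zc a)
    (hTZ : ∀ a Fn V, (R.TZ a).T Fn V = (PosOp.pi (T a) (l a)).T Fn V)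
    (b : Step.Budget.Consts) (Lb : ℝ) {Rk q : ℕ} (hRk : 0 < Rk) (hq : 0 < q)
    (hC : 0 ≤ b.C) (hbM : 0 ≤ b.M) (hRm : ∀ m, 0 ≤ b.R m) (hdim : b.d = 4) (hRq : ((Rk * q : ℕ) : ℝ) = Lb * b.R (k + 1)) (hLb : 0 ≤ Lb)
    (hslope2 : 2 * (κ₁ * (4 * 2 ^ 4) * Lb ^ b.d) ≤ b.C * b.M ^ b.d * b.R (k + 1))
    (X₀ : R.Adm → (tsys 4 Nc).Dom → Finset (Pt 4)) (K : R.Adm → (tsys 4 Nc).Dom → ℕ)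
    (κ Pp : R.Adm → (tsys 4 Nc).Dom → ℝ) (s : R.Adm → (tsys 4 Nc).Dom → ℕ → ℝ)
    (hdataZ : ∀ a, ∀ X ∈ R.Zc a, (X₀ a X).Nonempty ∧ FaceConnected (X₀ a X) ∧
      X.1 = (fineCubes Rk (X₀ a X)).image (proj Nc) ∧ 1 ≤ K a X ∧
      (∀ V, (T a X).T 1 V ≤ Real.exp (-(κ a X) - Pp a X)) ∧ Step.Budget.Controls b k (K a X) (κ a X) (s a X) ∧
      (∀ m, 0 ≤ s a X m) ∧ s a X (k + 1) = treeLen (Sop q (X₀ a X)) ∧ c₀ ≤ Pp a X)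
    -- the domains `Y_i`: composite structure and per-domain (1.80)⁺ horizon-0 data
    (TY : R.Adm → (tsys 4 Nc).Dom → PosOp (GaugeField (F.P P.K) k (SU N))) (lY : R.Adm → List (tsys 4 Nc).Dom)
    (hndY : ∀ a, (lY a).Nodup) (hsetY : ∀ a, (lY a).toFinset = R.Ys a)
    (hTYs : ∀ a Fn V, (R.TYs a).T Fn V = (PosOp.pi (TY a) (lY a)).T Fn V)
    (SY : R.Adm → (tsys 4 Nc).Dom → Finset (Pt 4)) (κY PY : R.Adm → (tsys 4 Nc).Dom → ℝ) (sY : R.Adm → (tsys 4 Nc).Dom → ℕ → ℝ)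
    (hdataY : ∀ a, ∀ Y ∈ R.Ys a, (SY a Y).Nonempty ∧ FaceConnected (SY a Y) ∧
      Y.1 = (fineCubes Rk (SY a Y)).image (proj Nc) ∧ (∀ V, (TY a Y).T 1 V ≤ Real.exp (-(κY a Y) - PY a Y)) ∧
      Step.Budget.Controls b k 0 (κY a Y - κ₁ * treeLen (fineCubes Rk (SY a Y))) (sY a Y) ∧ c₀ ≤ PY a Y)
    -- the (1.90) gas of every admissible term (verbatim)
    {LF DomY Cube Var Sv : Type*} [Fintype LF] [Fintype DomY] [Fintype Cube] [DecidableEq LF] [DecidableEq DomY]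
    [DecidableEq Cube] {adjC : Cube → Cube → Prop} [DecidableRel adjC]
    (hrefl : ∀ a, adjC a a) (hsymm : ∀ a b, adjC a b → adjC b a)
    {locX : LF → Finset Cube} {locY : DomY → Finset Cube} {site : Var → Cube} (Yfix : R.Adm → Finset Cube)
    (houtX : ∀ a j, (locX j \ Yfix a).Nonempty) (houtY : ∀ a Y, (locY Y \ Yfix a).Nonempty)
    (Op : R.Adm → Finset LF → ((Var → Sv) → ℂ) →+ ((Var → Sv) → ℂ))
    (hOps : ∀ a, LocalOps adjC locX (Yfix a) site (Op a))
    (hOpReal : ∀ a (S : Finset LF) (f : (Var → Sv) → ℂ), (∀ ψ, (f ψ).im = 0) → ∀ φ, (Op a S f φ).im = 0)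
    (Vt : R.Adm → DomY → (Var → Sv) → ℂ) (hV : ∀ a Y, DepOn (Yfix a) site (Vt a Y) (locY Y))
    (hVreal : ∀ a Y ψ, (Vt a Y ψ).im = 0) (cfg : GaugeField (F.P P.K) k (SU N) → (Var → Sv))
    {nbr : Cube → Finset Cube} (hnbr : ∀ a b, adjC a b → a ∈ nbr b) {νn : ℝ} (hν : ∀ b, ((nbr b).card : ℝ) ≤ νn)
    {d : R.Adm → Finset Cube → ℝ} {c₁ Rr κc K₀ cv τ : ℝ} (hd : ∀ a X, 0 ≤ d a X) (hc₁ : 0 ≤ c₁) (hK₀ : 0 ≤ K₀) (hτ : 0 ≤ τ)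
    (h197 : ∀ a V X, ‖F191 adjC locX locY (Yfix a) (mayerTerm (Op a) (Vt a) (cfg V)) X‖ ≤ c₁ * Real.exp (-(Rr * d a X)))
    (h126 : ∀ a, Ineq126 (polys190 adjC locX locY (Yfix a)) (fun X => X \ Yfix a) (d a) κc K₀)
    (hvol : ∀ a, VolBound (polys190 adjC locX locY (Yfix a)) (fun X => X \ Yfix a) (d a) cv)
    (hrate : κc + τ * cv ≤ Rr) (hsmall : c₁ * Real.exp (τ * cv) * K₀ * νn ≤ τ)
    (hjunction : ∀ a V, R.curly a V = (bracket (Op a) (Vt a) (cfg V)).re)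
    {πc : ℝ} (hQ : (Fintype.card Cube : ℝ) ≤ πc * (Fintype.card (Site (F.P P.K) k) : ℝ))
    -- dag-n11-e's supply chain on the live-selector line and [III] §3's two SUPPLY TOKENS at the chain witness ON PRINT's CLASS `bgReg`
    (σ : Sect3Supplier θ P)
    (hsel : θ.ppSel = ppSelLiveOfRecord F N θ.ν θ.τ9 (EOfRecord₁₃ F N θ.toStage13Params) (wOfRecord₉ F N θ.toStage9Params))
    (hθ : θ.Admissible F N) (hE₀ : 0 ≤ θ.s2.lf.E₀) (hB₀ : 0 ≤ θ.s2.lf.B₀) (hMτ : 1 ≤ θ.τ9.M)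
    (hκd : B12TreeDecay.kappa₀ (4 * 2 ^ (F.P P.K).d) (2 * (F.P P.K).d) ≤ θ.s2.lf.κ)
    (hσ : SupplierObligations θ P σ) (hT : NoExpansionObligation θ P σ)
    {bE cE κR cR : ℝ} {κ₀ : ℕ}
    (hES : Thm2ESupplyAt θ P (fun k s => (chainWitness θ P σ k).1 s) (fun k _ => bgReg F N P.K k θ.εbg) bE cE)
    (hRS : Thm2RSupplyAt θ P (fun k s => (chainWitness θ P σ k).1 s) (fun k _ => bgReg F N P.K k θ.εbg) κR cR κ₀)
    (hb1 : bE < 1) (hL : 1 < ((F.P P.K).L : ℝ)) (hκ7 : 7 ≤ κ₀)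
    (hg : ∀ j, j ≤ P.K → 0 ≤ gOfRecord₁₃ F N θ.toStage13Params P j)
    (hreg : ∀ k (s : SeqOfRecord F θ.ν θ.τ9.M (gOfRecord₁₃ F N θ.toStage13Params P) P.K k) (U : GaugeField (F.P P.K) 0 (SU N)), U ∈ bgReg F N P.K k θ.εbg →
      ∀ j, 1 ≤ j → j ≤ k → ∀ X, Sect2.admB (F.P P.K) θ.ν θ.τ9.M (gOfRecord₁₃ F N θ.toStage13Params P) s.Ω s.Λ j (Sect2.domSites (F.P P.K) θ.τ9.M j X) = true →
        Sect2.ofBackgroundC (ιSU N) U ∈ Sect2.spaceMS (settingOfRecord₁₃ F N θ.toStage13Params P) (θ.rzAt P s) θ.τ9.M j (Sect2.domSites (F.P P.K) θ.τ9.M j X) s.Ω)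
    (hk : k ≤ P.K)
    -- the configuration-indexed data READ THROUGH THE CARRIER: history, fluctuation argument, volumes (region and ring)
    (sV : (V : GaugeField (F.P P.K) k (SU N)) → SeqOfRecord F θ.ν θ.τ9.M (gOfRecord₁₃ F N θ.toStage13Params P) P.K k)
    (aV : GaugeField (F.P P.K) k (SU N) → Tk.SFluct (F.P P.K) (FluctV N))
    (Ek EkLog EkRest : ℝ) (hEk : Ek = EkLog + EkRest) (E₂ : ℝ) (Γ : ℕ → ℝ)
    (hΓvol : ∀ V, ∀ n, 1 ≤ n → n ≤ k → ((univ.filter fun y : Site (F.P P.K) n => toFine n y ∈ gammaRegion (sV V).Ω k n).card : ℝ) ≤ Γ n)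
    (hΓr : ∀ V, ∀ n, 1 ≤ n → n ≤ k →
      ((univ.filter fun c : TPt (F.P P.K).d (Sect2.domCount (F.P P.K) θ.τ9.M n) =>
          (Sect2.domSites (F.P P.K) θ.τ9.M n (Sect2.cubeDom (F.P P.K) θ.τ9.M n c) ∩
              Sect2.enlT (F.P P.K) (Sect2.zSide (F.P P.K) θ.ν θ.τ9.M (gOfRecord₁₃ F N θ.toStage13Params P) n) 1 ((sV V).Λ n)ᶜ).Nonempty ∧
            ∃ c', (c' = c ∨ TAdj c' c) ∧ (Sect2.domSites (F.P P.K) θ.τ9.M n (Sect2.cubeDom (F.P P.K) θ.τ9.M n c') ∩ (sV V).Ω n).Nonempty).card : ℝ) ≤ Γ n)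
    (hβj : ∀ j, 1 ≤ j → j ≤ k → 0 ≤ 1 / gOfRecord₁₃ F N θ.toStage13Params P (j - 1) ^ 2 - 1 / gOfRecord₁₃ F N θ.toStage13Params P j ^ 2)
    (hφ : ∀ V, ∀ j, 1 ≤ j → j ≤ k → ∀ x, θ.Phih P k (sV V).Ω (sV V).Λ j x ≤ 1)
    (hφ1 : ∀ V, chiβOfRecord₁₃ F N θ.toStage13Params P.K (gOfRecord₁₃ F N θ.toStage13Params P) k V ≠ 0 →
      ∀ j, 1 ≤ j → j ≤ k → ∀ x, θ.Phih P k (sV V).Ω (sV V).Λ j x = 1)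
    (hsum : ∀ n, 1 ≤ n → n ≤ k → ∑ j ∈ Icc 1 n, (gOfRecord₁₃ F N θ.toStage13Params P j) ^ κ₀ ≤ (gOfRecord₁₃ F N θ.toStage13Params P n) ^ (κ₀ - 6))
    (hsmall6 : ∀ n, 1 ≤ n → n ≤ k →
      cR * B12TreeDecay.K₀ (4 * 2 ^ (F.P P.K).d) (2 * (F.P P.K).d) * (gOfRecord₁₃ F N θ.toStage13Params P n) ^ (κ₀ - 6) ≤ 1)
    (hvac : VacuumRestBound EkRest E₂ Γ k)
    (hA'eq : ∀ V, R.A' V =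
      (sect2ActionDataOfRecord F N (FluctV N) P.K (settingOfRecord₁₃ F N θ.toStage13Params P) (θ.rzAt P (sV V)) (sV V)
        ((chainWitness θ P σ k).1 (sV V)) (aV V) Ek).action23 k (Uk F N P.K k θ.εbg V))
    -- the sizes of the logarithmic vacuum term, the volume majorant, the sign of the `E₁`-free part of Theorem 2's constant
    {cΓ cL cL' : ℝ} (hrest : 0 ≤ 1 + 2 * (θ.s2.lf.B₀ * B12TreeDecay.K₀ (4 * 2 ^ (F.P P.K).d) (2 * (F.P P.K).d)) + E₂)
    (hΓ : ∑ n ∈ Icc 1 k, Γ n ≤ cΓ * (Fintype.card (Site (F.P P.K) k) : ℝ))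
    (hlog : -(cL * (Fintype.card (Site (F.P P.K) k) : ℝ)) ≤ -EkLog)
    (hlog' : -EkLog ≤ cL' * (Fintype.card (Site (F.P P.K) k) : ℝ)) :
    ∀ V : GaugeField (F.P P.K) k (SU N),
      B16.UVIneq ((datumOfRecord₁₃CoPH F N θ h).C P) k V
        ((cE * (1 - ((F.P P.K).L : ℝ) ^ (-(1 - bE)))⁻¹ + 1 + 2 * (θ.s2.lf.B₀ * B12TreeDecay.K₀ (4 * 2 ^ (F.P P.K).d) (2 * (F.P P.K).d)) + E₂) * cΓ + cL +
          πc * (c₁ * Real.exp (τ * cv) * K₀))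
        ((cE * (1 - ((F.P P.K).L : ℝ) ^ (-(1 - bE)))⁻¹ + 1 + 2 * (θ.s2.lf.B₀ * B12TreeDecay.K₀ (4 * 2 ^ (F.P P.K).d) (2 * (F.P P.K).d)) + E₂) * cΓ + cL' +
          πc * (c₁ * Real.exp (τ * cv) * K₀) + M₁⁻¹ ^ 4 * B12TreeDecay.K₀ (4 * 2 ^ 4) (2 * 4) * ∑ _i : Fin 2, Real.exp (-c₀)) :=
  uvIneq_at_record₁₃CoPH_of_thm2Supply_chainWitness_of_obligations_of_fullBudget F N θ h P k (fun k _ => bgReg F N P.K k θ.εbg) Nc R hM hnum hκ hκ₁ c₀ hH hχ01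
    h0χ T l hnd hset hTZ b Lb hRk hq hC hbM hRm hdim hRq hLb hslope2 X₀ K κ Pp s hdataZ TY lY hndY hsetY hTYs SY κY PY sY hdataY hrefl hsymm Yfix houtX houtY
    Op hOps hOpReal Vt hV hVreal cfg hnbr hν hd hc₁ hK₀ hτ h197 h126 hvol hrate hsmall hjunction hQ σ hsel hθ hE₀ hB₀ hMτ hκd hσ hT hES hRS hb1 hL hκ7 hg
    hreg hk sV (fun V => Uk_mem_bgReg_all F N P.K k hθ.1.1.1.2 V) aV Ek EkLog EkRest hEk E₂ Γ hΓvol hΓr hβj hφ hφ1 hsum hsmall6 hvac hA'eq hrest hΓ hlog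
    hlog'

end SupplyAtBgReg

end Summit.QuantumFields.YangMills.BalabanUVNodes.N13Cor3AsymJunctionThm2KeyedAtBgRegFullBudgetAtRecord13CoPH

end
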